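import Mathlib.Topology.MetricSpace.Thickening
import Mathlib.Topology.Maps.OpenQuotient
import Literature.Probability.RandomPlanarGeometry.ChordalCurveFamilyProofs
import HarnessLib

/-!
# First-contact continuity: `stopAt F` and the first-hitting point ARE continuous at curves
# entering `F` immediately (stub `stub_tournamentTransfer`, step (b2)/(c), line
# `hitting-tournament`, crux `CardySelfRefinement.LagHandOff`, stmt-CriticalPhenomena-10268)

Registered sub-goal `stub_tournamentTransfer_firstContactContinuity`.  Deterministic analysis in
the Aizenman–Burchard curve space (`Curve E` with the reparametrisation pseudo-distance,
`CurveClass E` its metric quotient); no probability.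

The standing negative lemma `Theorems/LagHandOff/Negative/StopAtDiscontinuity.lean`
(`not_continuousAt_mk_stopAt`): at a curve whose first contact with a closed set `F` is a
ONE-SIDED TOUCHING (a limit of curves avoiding `F`, first-contact point `≠` endpoint) the
stopping map `c ↦ [c.stopAt F]` is discontinuous.  This file is the CONVERSE COMPANION the line
uses to pass first-hitting data of lattice interfaces to the limit curve.  At a curve `γ` which,
after first hitting `F` at `σ = hitParam F γ`, visits the INTERIOR of `F` at parameters
arbitrarily close to `σ` ("immediate entry" — the behaviour expected almost surely of the limit
interface at an interior cross-cut; that probabilistic half is not treated here), and at every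
curve with `σ = 1` (e.g. avoiding `F`):
* `c ↦ c.stopAt F` is continuous at `γ` on parametrised curves (`continuousAt_stopAt`), hence so
  are the stopped class `c ↦ [c.stopAt F]`, the first-hitting POINT `c ↦ c σ_c` (endpoint of the
  stopped curve, a `1`-Lipschitz functional), `CurveClass.stopAt F` at `[γ]` (open quotient map
  `mk` + representative independence `CurveClass.stopAt_mk_holds`) and its endpoint;
* ORDER bits: if `γ` is in the interior of `F` at a parameter before its first contact with a
  closed `F'` (e.g. `σ_F < σ_{F'}` with immediate entry into `F`), all curves near `γ` hit `F`
  strictly before `F'` with a `hitsBefore`-witness, so `hitsBefore F F'` and `(hitsBefore F' F)ᶜ`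
  are neighbourhoods of `[γ]` (both order events are locally constant there).

Proof.  A curve at distance `< δ` from `γ` has a reparametrisation at sup distance `< δ`
(`Curve.exists_dist_reparam_lt`) and stopping commutes with reparametrisation modulo distance `0`
(`Curve.dist_stopAt_stopAt_eq_zero`): reduce to curves `c` uniformly `δ`-close to `γ`.  Lower
bound (closedness only): the compact arc `γ([0, a])`, `a < σ`, has a thickening inside the open
set `Fᶜ`, so `c` avoids `F` up to time `a`.  Upper bound (immediate entry): a ball around an
interior visit `γ t₀`, `σ < t₀ < σ + η`, lies in `F` and contains `c t₀`.  So `σ_c` is `δ₁`-close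
to `σ`, and `c.stopAt F = c ∘ affineClamp 0 σ_c` is uniformly close to `γ ∘ affineClamp 0 σ_c`,
which is close to `γ.stopAt F = γ ∘ affineClamp 0 σ` (`Curve.exists_dist_comp_affineClamp_le`).

References: M. Aizenman, A. Burchard, Duke Math. J. 99 (1999) §2.1 (the curve space); the
statements are re-parametrisation folklore.
-/

noncomputable section

open Set Filter Topology Metric
open scoped unitInterval
open Literature.Probability.RandomPlanarGeometry

namespace Summit.CriticalPhenomena.CardyFormulaZ2.Cruxes.LagHandOff.HittingTournament

namespace FirstContact

/-! ### Curves uniformly close to `γ`: two-sided control of the first-hitting parameter -/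

section PseudoMetric

variable {E : Type*} [PseudoMetricSpace E]

/-- Pointwise form of a sup-distance bound between the parametrisations of two curves. -/
theorem dist_apply_lt_of_dist_lt {γ c : Curve E} {δ : ℝ}
    (h : dist γ.toContinuousMap c.toContinuousMap < δ) (t : I) : dist (γ t) (c t) < δ :=
  (ContinuousMap.dist_apply_le_dist (f := γ.toContinuousMap) (g := c.toContinuousMap) t).trans_lt h

/-- **Lower bound (closedness only).** If `a < hitParam F γ` for a closed set `F`, every curve
uniformly close to `γ` avoids `F` up to parameter `a`, hence has first-hitting parameter `≥ a`:
the compact arc `γ([0, a])` has a thickening inside the open set `Fᶜ`. -/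
theorem exists_forall_le_hitParam {F : Set E} (hF : IsClosed F) (γ : Curve E) {a : ℝ}
    (ha : a < γ.hitParam F) :
    ∃ δ > 0, ∀ c : Curve E, dist γ.toContinuousMap c.toContinuousMap < δ →
      (∀ t : I, (t : ℝ) ≤ a → c t ∉ F) ∧ a ≤ c.hitParam F := by
  have hK : IsCompact (γ '' {t : I | (t : ℝ) ≤ a}) :=
    ((isClosed_le continuous_subtype_val continuous_const).isCompact).image γ.continuous
  have hKF : γ '' {t : I | (t : ℝ) ≤ a} ⊆ Fᶜ := by
    rintro _ ⟨t, ht, rfl⟩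
    exact Curve.notMem_of_lt_hitParam (lt_of_le_of_lt ht ha)
  obtain ⟨δ, hδ, hthick⟩ := hK.exists_thickening_subset_open hF.isOpen_compl hKF
  refine ⟨δ, hδ, fun c hc => ?_⟩
  have havoid : ∀ t : I, (t : ℝ) ≤ a → c t ∉ F := by
    intro t ht hmem
    refine hthick ?_ hmem
    rw [mem_thickening_iff]
    exact ⟨γ t, ⟨t, ht, rfl⟩, by rw [dist_comm]; exact dist_apply_lt_of_dist_lt hc t⟩
  refine ⟨havoid, le_csInf ⟨1, c.one_mem_hitSet F⟩ ?_⟩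
  rintro s (⟨hs, hmem⟩ | hs)
  · exact le_of_lt (lt_of_not_ge fun h => havoid ⟨s, hs⟩ h hmem)
  · rw [mem_singleton_iff.1 hs]
    exact ha.le.trans (γ.hitParam_mem_Icc F).2

/-- **Upper bound at an interior visit.** If `γ t₀ ∈ interior F` then every curve uniformly
close to `γ` is in the interior of `F` at parameter `t₀`, hence has first-hitting parameter
`≤ t₀`. -/
theorem exists_forall_mem_interior (γ : Curve E) {F : Set E} {t₀ : I}
    (ht₀ : γ t₀ ∈ interior F) :
    ∃ δ > 0, ∀ c : Curve E, dist γ.toContinuousMap c.toContinuousMap < δ →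
      c t₀ ∈ interior F ∧ c.hitParam F ≤ t₀ := by
  obtain ⟨δ, hδ, hball⟩ := Metric.isOpen_iff.1 isOpen_interior (γ t₀) ht₀
  refine ⟨δ, hδ, fun c hc => ?_⟩
  have hmem : c t₀ ∈ interior F :=
    hball (by rw [mem_ball, dist_comm]; exact dist_apply_lt_of_dist_lt hc t₀)
  exact ⟨hmem, Curve.hitParam_le (interior_subset hmem)⟩

/-- **Upper bound under immediate entry.** If `γ` visits the interior of `F` at parameters
arbitrarily close after its first-hitting parameter `σ` (no condition when `σ = 1`), then for
every `η > 0` all curves uniformly close to `γ` have first-hitting parameter `≤ σ + η`. -/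
theorem exists_forall_hitParam_le (γ : Curve E) {F : Set E}
    (hent : γ.hitParam F < 1 → ∀ ε : ℝ, 0 < ε →
      ∃ t : I, γ.hitParam F < (t : ℝ) ∧ (t : ℝ) < γ.hitParam F + ε ∧ γ t ∈ interior F)
    {η : ℝ} (hη : 0 < η) :
    ∃ δ > 0, ∀ c : Curve E, dist γ.toContinuousMap c.toContinuousMap < δ →
      c.hitParam F ≤ γ.hitParam F + η := by
  rcases lt_or_ge (γ.hitParam F) 1 with h1 | h1
  · obtain ⟨t₀, -, ht₀, hint⟩ := hent h1 η hη
    obtain ⟨δ, hδ, hc⟩ := exists_forall_mem_interior γ hint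
    exact ⟨δ, hδ, fun c hcd => (hc c hcd).2.trans ht₀.le⟩
  · exact ⟨1, one_pos, fun c _ =>
      (c.hitParam_mem_Icc F).2.trans (h1.trans (le_add_of_nonneg_right hη.le))⟩

/-- **Stopped curves of uniformly close curves.** Under immediate entry (or `σ = 1`), for closed
`F` and every `ε > 0`, all curves `c` uniformly close to `γ` have hitting parameter `ε`-close to
`σ = hitParam F γ` and stopped curve `c.stopAt F` at reparametrisation distance `< ε` from
`γ.stopAt F`: `c.stopAt F = c ∘ affineClamp 0 (hitParam F c)` is uniformly close to
`γ ∘ affineClamp 0 (hitParam F c)`, which is close to `γ ∘ affineClamp 0 σ = γ.stopAt F` by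
uniform continuity of `γ`. -/
theorem exists_forall_dist_stopAt_lt {F : Set E} (hF : IsClosed F) (γ : Curve E)
    (hent : γ.hitParam F < 1 → ∀ ε : ℝ, 0 < ε →
      ∃ t : I, γ.hitParam F < (t : ℝ) ∧ (t : ℝ) < γ.hitParam F + ε ∧ γ t ∈ interior F)
    {ε : ℝ} (hε : 0 < ε) :
    ∃ δ > 0, ∀ c : Curve E, dist γ.toContinuousMap c.toContinuousMap < δ →
      |c.hitParam F - γ.hitParam F| ≤ ε ∧ dist (c.stopAt F) (γ.stopAt F) < ε := by
  -- modulus of continuity of `γ` for clamped affine reparametrisations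
  obtain ⟨δ₁, hδ₁, hmod⟩ := Curve.exists_dist_comp_affineClamp_le γ (half_pos hε)
  -- two-sided control of the hitting parameter, at scale `min δ₁ ε`
  have hm : 0 < min δ₁ ε := lt_min hδ₁ hε
  obtain ⟨δ₂, hδ₂, hlow⟩ := exists_forall_le_hitParam hF γ
    (show γ.hitParam F - min δ₁ ε < γ.hitParam F by linarith)
  obtain ⟨δ₃, hδ₃, hup⟩ := exists_forall_hitParam_le γ hent hm
  refine ⟨min (ε / 2) (min δ₂ δ₃), lt_min (half_pos hε) (lt_min hδ₂ hδ₃), fun c hc => ?_⟩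
  rw [lt_min_iff, lt_min_iff] at hc
  obtain ⟨hcε, hc₂, hc₃⟩ := hc
  have hT : |c.hitParam F - γ.hitParam F| ≤ min δ₁ ε := by
    rw [abs_sub_le_iff]
    constructor
    · linarith [hup c hc₃]
    · linarith [(hlow c hc₂).2]
  refine ⟨hT.trans (min_le_right _ _), ?_⟩
  have hT₁ : |c.hitParam F - γ.hitParam F| ≤ δ₁ := hT.trans (min_le_left _ _)
  calc dist (c.stopAt F) (γ.stopAt F)
      ≤ dist (c.stopAt F)
            (⟨γ.toContinuousMap.comp (Curve.affineClamp 0 (c.hitParam F))⟩ : Curve E) +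
          dist (⟨γ.toContinuousMap.comp (Curve.affineClamp 0 (c.hitParam F))⟩ : Curve E)
            (γ.stopAt F) := dist_triangle _ _ _
    _ < ε / 2 + ε / 2 := by
        refine add_lt_add_of_lt_of_le ?_ ?_
        · refine (Curve.dist_comp_comp_le_dist c γ _).trans_lt ?_
          rwa [dist_comm]
        · exact hmod 0 (c.hitParam F) 0 (γ.hitParam F)
            (by rw [sub_self, abs_zero]; exact hδ₁.le) hT₁
    _ = ε := add_halves ε

/-- **ORDER bits, uniformly close curves reduced to the reparametrisation ball.** If `γ` is in the
interior of `F` at a parameter `t₀` before its first contact with the closed set `F'`, then every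
curve `c` at reparametrisation distance small enough from `γ` visits the interior of `F` at a
parameter up to which it avoids `F'`; in particular `hitParam F c < hitParam F' c`. -/
theorem exists_forall_hitParam_lt {F F' : Set E} (hF' : IsClosed F') (γ : Curve E) {t₀ : I}
    (ht₀ : γ t₀ ∈ interior F) (hlt : (t₀ : ℝ) < γ.hitParam F') :
    ∃ δ > 0, ∀ c : Curve E, dist c γ < δ →
      c.hitParam F < c.hitParam F' ∧ ∃ s : I, c s ∈ interior F ∧ ∀ u : I, u ≤ s → c u ∉ F' := by
  obtain ⟨δ₁, hδ₁, hin⟩ := exists_forall_mem_interior γ ht₀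
  obtain ⟨δ₂, hδ₂, hout⟩ := exists_forall_le_hitParam hF' γ hlt
  refine ⟨min δ₁ δ₂, lt_min hδ₁ hδ₂, fun c hc => ?_⟩
  rw [dist_comm] at hc
  obtain ⟨φ, hφ⟩ := Curve.exists_dist_reparam_lt hc
  have h1 : (c.reparam φ) t₀ ∈ interior F := (hin _ (hφ.trans_le (min_le_left _ _))).1
  have h2 : ∀ t : I, (t : ℝ) ≤ t₀ → (c.reparam φ) t ∉ F' :=
    (hout _ (hφ.trans_le (min_le_right _ _))).1
  rw [Curve.reparam_apply] at h1
  have havoid : ∀ u : I, u ≤ φ t₀ → c u ∉ F' := by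
    intro u hu
    have hu' : φ.symm u ≤ t₀ := by simpa using φ.symm.monotone hu
    have := h2 (φ.symm u) hu'
    rwa [Curve.reparam_apply, OrderIso.apply_symm_apply] at this
  -- the witness parameter `φ t₀` is `< 1`, so the strict order of hitting parameters follows
  have ht1 : t₀ < ⊤ := Subtype.coe_lt_coe.1 (hlt.trans_le (γ.hitParam_mem_Icc F').2)
  have hs1 : ((φ t₀ : I) : ℝ) < 1 := by
    show ((φ t₀ : I) : ℝ) < ((⊤ : I) : ℝ)
    exact Subtype.coe_lt_coe.2 ((φ.strictMono ht1).trans_le le_top)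
  refine ⟨(Curve.hitParam_le (interior_subset h1)).trans_lt ?_, φ t₀, h1, havoid⟩
  rcases Curve.hitParam_mem_hitSet hF' c with ⟨hI, hmem⟩ | h1'
  · exact lt_of_not_ge fun h => havoid ⟨_, hI⟩ h hmem
  · rw [mem_singleton_iff.1 h1']
    exact hs1

/-- **ORDER bits are locally constant off ties**: under the hypotheses of
`exists_forall_hitParam_lt`, eventually along `𝓝 γ` the curve hits `F` strictly before `F'`,
with a `hitsBefore`-witness. -/
theorem eventually_hitParam_lt {F F' : Set E} (hF' : IsClosed F') (γ : Curve E) {t₀ : I}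
    (ht₀ : γ t₀ ∈ interior F) (hlt : (t₀ : ℝ) < γ.hitParam F') :
    ∀ᶠ c in 𝓝 γ, c.hitParam F < c.hitParam F' ∧
      ∃ s : I, c s ∈ interior F ∧ ∀ u : I, u ≤ s → c u ∉ F' := by
  obtain ⟨δ, hδ, h⟩ := exists_forall_hitParam_lt hF' γ ht₀ hlt
  exact Metric.eventually_nhds_iff.2 ⟨δ, hδ, fun c hc => h c hc⟩

end PseudoMetric

/-! ### Continuity of stopping and of the first-hitting point at immediate-entry curves -/

section Metric

variable {E : Type*} [MetricSpace E]

/-- **Continuity of `stopAt F` on parametrised curves.** For closed `F`, at every curve `γ`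
which enters the interior of `F` immediately after first hitting it (no condition if the
first-hitting parameter is `1`, e.g. if `γ` avoids `F`), the map `c ↦ c.stopAt F` is continuous
for the reparametrisation pseudo-distance.  Reduction to uniformly close curves by
`Curve.exists_dist_reparam_lt` and `Curve.dist_stopAt_stopAt_eq_zero`. -/
theorem continuousAt_stopAt {F : Set E} (hF : IsClosed F) {γ : Curve E}
    (hent : γ.hitParam F < 1 → ∀ ε : ℝ, 0 < ε →
      ∃ t : I, γ.hitParam F < (t : ℝ) ∧ (t : ℝ) < γ.hitParam F + ε ∧ γ t ∈ interior F) :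
    ContinuousAt (fun c : Curve E => c.stopAt F) γ := by
  rw [Metric.continuousAt_iff]
  intro ε hε
  obtain ⟨δ, hδ, h⟩ := exists_forall_dist_stopAt_lt hF γ hent hε
  refine ⟨δ, hδ, fun c hc => ?_⟩
  rw [dist_comm] at hc
  obtain ⟨φ, hφ⟩ := Curve.exists_dist_reparam_lt hc
  have h0 : dist (c.stopAt F) ((c.reparam φ).stopAt F) = 0 :=
    Curve.dist_stopAt_stopAt_eq_zero hF (Curve.dist_reparam_self c φ)
  calc dist (c.stopAt F) (γ.stopAt F)
      ≤ dist (c.stopAt F) ((c.reparam φ).stopAt F) +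
          dist ((c.reparam φ).stopAt F) (γ.stopAt F) := dist_triangle _ _ _
    _ = dist ((c.reparam φ).stopAt F) (γ.stopAt F) := by rw [h0, zero_add]
    _ < ε := (h _ hφ).2

/-- **Continuity of the stopped CLASS** `c ↦ [c.stopAt F]` at immediate-entry curves (the map of
`Negative.StopAtDiscontinuity.not_continuousAt_mk_stopAt`). -/
theorem continuousAt_mk_stopAt {F : Set E} (hF : IsClosed F) {γ : Curve E}
    (hent : γ.hitParam F < 1 → ∀ ε : ℝ, 0 < ε →
      ∃ t : I, γ.hitParam F < (t : ℝ) ∧ (t : ℝ) < γ.hitParam F + ε ∧ γ t ∈ interior F) :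
    ContinuousAt (fun c : Curve E => CurveClass.mk (c.stopAt F)) γ :=
  (CurveClass.continuous_mk.tendsto _).comp (continuousAt_stopAt hF hent)

/-- **Continuity of the first-hitting POINT** `c ↦ c (hitParam F c)` at immediate-entry curves:
it is the endpoint of the stopped curve (`Curve.target_stopAt`), a `1`-Lipschitz functional
(`Curve.dist_target_le`). -/
theorem continuousAt_hitPoint {F : Set E} (hF : IsClosed F) {γ : Curve E}
    (hent : γ.hitParam F < 1 → ∀ ε : ℝ, 0 < ε →
      ∃ t : I, γ.hitParam F < (t : ℝ) ∧ (t : ℝ) < γ.hitParam F + ε ∧ γ t ∈ interior F) :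
    ContinuousAt (fun c : Curve E => c ⟨c.hitParam F, c.hitParam_mem_Icc F⟩) γ := by
  have h := ((LipschitzWith.mk_one Curve.dist_target_le).continuous.tendsto _).comp
    (continuousAt_stopAt hF hent)
  simpa only [ContinuousAt, Function.comp_def, Curve.target_stopAt] using h

/-- `CurveClass.mk` is an open quotient map (it is `SeparationQuotient.mk`). -/
theorem isOpenQuotientMap_curveClassMk :
    IsOpenQuotientMap (CurveClass.mk : Curve E → CurveClass E) := by
  rw [CurveClass.mk_eq_separationQuotientMk]
  exact SeparationQuotient.isOpenQuotientMap_mk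

/-- **Continuity of `CurveClass.stopAt F` at the class of an immediate-entry curve**: a map on
the quotient is continuous at `[γ]` iff its composite with the open quotient map `mk` is
continuous at `γ`, and `CurveClass.stopAt F ∘ mk = mk ∘ Curve.stopAt F` for closed `F`
(`CurveClass.stopAt_mk_holds`). -/
theorem continuousAt_curveClassStopAt {F : Set E} (hF : IsClosed F) {γ : Curve E}
    (hent : γ.hitParam F < 1 → ∀ ε : ℝ, 0 < ε →
      ∃ t : I, γ.hitParam F < (t : ℝ) ∧ (t : ℝ) < γ.hitParam F + ε ∧ γ t ∈ interior F) :
    ContinuousAt (CurveClass.stopAt F) (CurveClass.mk γ) := by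
  have hfun : (fun c : Curve E => CurveClass.mk (c.stopAt F)) =
      CurveClass.stopAt F ∘ CurveClass.mk := by
    funext c
    exact (CurveClass.stopAt_mk_holds F hF c).symm
  rw [← isOpenQuotientMap_curveClassMk.continuousAt_comp_iff, ← hfun]
  exact continuousAt_mk_stopAt hF hent

/-- The class-level first-hitting point `x ↦ (CurveClass.stopAt F x).target` is continuous at
the class of an immediate-entry curve. -/
theorem continuousAt_target_curveClassStopAt {F : Set E} (hF : IsClosed F) {γ : Curve E}
    (hent : γ.hitParam F < 1 → ∀ ε : ℝ, 0 < ε →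
      ∃ t : I, γ.hitParam F < (t : ℝ) ∧ (t : ℝ) < γ.hitParam F + ε ∧ γ t ∈ interior F) :
    ContinuousAt (fun x : CurveClass E => (CurveClass.stopAt F x).target) (CurveClass.mk γ) :=
  (CurveClass.continuous_target.tendsto _).comp (continuousAt_curveClassStopAt hF hent)

/-- A curve avoiding `F` satisfies the immediate-entry hypothesis vacuously (its first-hitting
parameter is `1`). -/
theorem entry_of_forall_notMem {F : Set E} {γ : Curve E} (h : ∀ t, γ t ∉ F) :
    γ.hitParam F < 1 → ∀ ε : ℝ, 0 < ε → ∃ t : I, γ.hitParam F < (t : ℝ) ∧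
      (t : ℝ) < γ.hitParam F + ε ∧ γ t ∈ interior F :=
  fun hlt => absurd (Curve.hitParam_eq_one_of_forall_notMem h) hlt.ne

/-- **The crossing event `hitsBefore F F'` is a neighbourhood of `[γ]`** when `γ` is in the
interior of `F` at a parameter before its first contact with the closed set `F'`. -/
theorem hitsBefore_mem_nhds {F F' : Set E} (hF' : IsClosed F') (γ : Curve E) {t₀ : I}
    (ht₀ : γ t₀ ∈ interior F) (hlt : (t₀ : ℝ) < γ.hitParam F') :
    CurveClass.hitsBefore F F' ∈ 𝓝 (CurveClass.mk γ) := by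
  obtain ⟨δ, hδ, h⟩ := exists_forall_hitParam_lt hF' γ ht₀ hlt
  refine Metric.mem_nhds_iff.2 ⟨δ, hδ, fun x hx => ?_⟩
  obtain ⟨c, rfl⟩ := CurveClass.surjective_mk x
  rw [mem_ball, CurveClass.dist_mk_mk] at hx
  obtain ⟨-, s, hs, havoid⟩ := h c hx
  exact CurveClass.mk_mem_hitsBefore (interior_subset hs) havoid

/-- Under the same hypotheses `[γ]` is not on the frontier of the event `hitsBefore F F'`. -/
theorem mk_notMem_frontier_hitsBefore {F F' : Set E} (hF' : IsClosed F') (γ : Curve E) {t₀ : I}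
    (ht₀ : γ t₀ ∈ interior F) (hlt : (t₀ : ℝ) < γ.hitParam F') :
    CurveClass.mk γ ∉ frontier (CurveClass.hitsBefore F F') :=
  fun h => h.2 (mem_interior_iff_mem_nhds.2 (hitsBefore_mem_nhds hF' γ ht₀ hlt))

/-- **The reversed crossing event `hitsBefore F' F` is avoided near `[γ]`** (closed `F`, `F'`):
every class close to `[γ]` has ALL its representatives `c̃` close to `γ`, so
`hitParam F c̃ < hitParam F' c̃`, and `c̃` (which meets the closed set `F`, at its first-hitting
parameter) cannot visit `F'` at a parameter up to which it avoids `F`. Together with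
`hitsBefore_mem_nhds`: both ORDER events are locally constant at `[γ]`. -/
theorem compl_hitsBefore_mem_nhds {F F' : Set E} (hF : IsClosed F) (hF' : IsClosed F')
    (γ : Curve E) {t₀ : I} (ht₀ : γ t₀ ∈ interior F) (hlt : (t₀ : ℝ) < γ.hitParam F') :
    (CurveClass.hitsBefore F' F)ᶜ ∈ 𝓝 (CurveClass.mk γ) := by
  obtain ⟨δ, hδ, h⟩ := exists_forall_hitParam_lt hF' γ ht₀ hlt
  refine Metric.mem_nhds_iff.2 ⟨δ, hδ, fun x hx hmem => ?_⟩
  obtain ⟨c, ⟨t, htF', havoidF⟩, rfl⟩ := hmem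
  rw [mem_ball, CurveClass.dist_mk_mk] at hx
  obtain ⟨hlt', -⟩ := h c hx
  -- `c` meets `F` (its first-hitting parameter is `< hitParam F' c ≤ 1`), at a parameter `≤ t`
  have hhit : ∃ u, c u ∈ F := not_forall_not.1 fun hno => absurd
    (Curve.hitParam_eq_one_of_forall_notMem hno) (hlt'.trans_le (c.hitParam_mem_Icc F').2).ne
  exact havoidF ⟨c.hitParam F, c.hitParam_mem_Icc F⟩
    (Subtype.coe_le_coe.1 (hlt'.le.trans (Curve.hitParam_le htF')))
    (Curve.apply_hitParam_mem hF hhit)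

/-- Immediate entry into `F` and a strictly later first contact with `F'` give a parameter at
which `γ` is in the interior of `F` before it first meets `F'` (hypothesis of the ORDER bits). -/
theorem exists_mem_interior_of_entry {F F' : Set E} {γ : Curve E}
    (hent : ∀ ε : ℝ, 0 < ε → ∃ t : I, γ.hitParam F < (t : ℝ) ∧
      (t : ℝ) < γ.hitParam F + ε ∧ γ t ∈ interior F)
    (hlt : γ.hitParam F < γ.hitParam F') :
    ∃ t₀ : I, γ t₀ ∈ interior F ∧ (t₀ : ℝ) < γ.hitParam F' := by
  obtain ⟨t₀, -, ht₀, hint⟩ := hent (γ.hitParam F' - γ.hitParam F) (sub_pos.2 hlt)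
  exact ⟨t₀, hint, by linarith⟩

end Metric

end FirstContact

/-! ### The registered sub-goal stub -/

/-- **Registered sub-goal stub `stub_tournamentTransfer_firstContactContinuity`** (line
`hitting-tournament`, step (b2)/(c) of `stub_tournamentTransfer`; converse companion of
`Negative.StopAtDiscontinuity`).  For a closed set `F ⊆ ℂ`:
(A) at a curve avoiding `F`, and (B) at a curve which enters the interior of `F` immediately
after first hitting it, the stopped curve `c ↦ c.stopAt F`, the stopped class `c ↦ [c.stopAt F]`,
the first-hitting point `c ↦ c (hitParam F c)` and (C) the class-level stopping map
`CurveClass.stopAt F` and class-level first-hitting point `x ↦ (CurveClass.stopAt F x).target`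
are continuous; (D) if a curve is in the interior of the closed set `F` at a parameter before its
first contact with the closed set `F'`, the crossing event `hitsBefore F F'` and the complement
of the reversed event `hitsBefore F' F` are neighbourhoods of its class, and all nearby curves
hit `F` strictly before `F'`. -/
theorem stub_tournamentTransfer_firstContactContinuity :
    (∀ {F : Set ℂ}, IsClosed F → ∀ {γ : Curve ℂ}, (∀ t, γ t ∉ F) →
      ContinuousAt (fun c : Curve ℂ => c.stopAt F) γ ∧
      ContinuousAt (fun c : Curve ℂ => CurveClass.mk (c.stopAt F)) γ ∧
      ContinuousAt (fun c : Curve ℂ => c ⟨c.hitParam F, c.hitParam_mem_Icc F⟩) γ ∧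
      ContinuousAt (CurveClass.stopAt F) (CurveClass.mk γ) ∧
      ContinuousAt (fun x : CurveClass ℂ => (CurveClass.stopAt F x).target) (CurveClass.mk γ)) ∧
    (∀ {F : Set ℂ}, IsClosed F → ∀ {γ : Curve ℂ}, (∃ t, γ t ∈ F) →
      (∀ ε : ℝ, 0 < ε → ∃ t : unitInterval, γ.hitParam F < (t : ℝ) ∧
        (t : ℝ) < γ.hitParam F + ε ∧ γ t ∈ interior F) →
      ContinuousAt (fun c : Curve ℂ => c.stopAt F) γ ∧
      ContinuousAt (fun c : Curve ℂ => CurveClass.mk (c.stopAt F)) γ ∧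
      ContinuousAt (fun c : Curve ℂ => c ⟨c.hitParam F, c.hitParam_mem_Icc F⟩) γ ∧
      ContinuousAt (CurveClass.stopAt F) (CurveClass.mk γ) ∧
      ContinuousAt (fun x : CurveClass ℂ => (CurveClass.stopAt F x).target) (CurveClass.mk γ)) ∧
    (∀ {F F' : Set ℂ}, IsClosed F → IsClosed F' → ∀ {γ : Curve ℂ} {t₀ : unitInterval},
      γ t₀ ∈ interior F → (t₀ : ℝ) < γ.hitParam F' →
      CurveClass.hitsBefore F F' ∈ 𝓝 (CurveClass.mk γ) ∧
      (CurveClass.hitsBefore F' F)ᶜ ∈ 𝓝 (CurveClass.mk γ) ∧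
      ∀ᶠ c in 𝓝 γ, c.hitParam F < c.hitParam F' ∧
        ∃ s : unitInterval, c s ∈ interior F ∧ ∀ u : unitInterval, u ≤ s → c u ∉ F') := by
  refine ⟨fun hF γ havoid => ?_, fun hF γ _ hent => ?_, fun hF hF' γ t₀ ht₀ hlt => ?_⟩
  · have hent := FirstContact.entry_of_forall_notMem havoid
    exact ⟨FirstContact.continuousAt_stopAt hF hent, FirstContact.continuousAt_mk_stopAt hF hent,
      FirstContact.continuousAt_hitPoint hF hent,
      FirstContact.continuousAt_curveClassStopAt hF hent,
      FirstContact.continuousAt_target_curveClassStopAt hF hent⟩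
  · exact ⟨FirstContact.continuousAt_stopAt hF fun _ => hent,
      FirstContact.continuousAt_mk_stopAt hF fun _ => hent,
      FirstContact.continuousAt_hitPoint hF fun _ => hent,
      FirstContact.continuousAt_curveClassStopAt hF fun _ => hent,
      FirstContact.continuousAt_target_curveClassStopAt hF fun _ => hent⟩
  · exact ⟨FirstContact.hitsBefore_mem_nhds hF' γ ht₀ hlt,
      FirstContact.compl_hitsBefore_mem_nhds hF hF' γ ht₀ hlt,
      FirstContact.eventually_hitParam_lt hF' γ ht₀ hlt⟩

end Summit.CriticalPhenomena.CardyFormulaZ2.Cruxes.LagHandOff.HittingTournament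

end
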